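import Summits.Ventures.QEC.Census.OrbitBZCoverWitPacked
import HarnessLib

/-!
# Witnessed translation-orbit label cover, TABLE form (qec-search-10 g3): no `2^k`-bit cover mask, no per-probe
# transport — per label ONE equation between XORs of small words

Measured on the farm (A.1 row `[[168,14,10]]`, 5 blocks, 83 translations): the mask-based witnessed chunk
(`coverAutWitPackOK`, `Census/OrbitBZCoverWitPacked.lean`) costs ≈ 9 ms per label in the kernel and a 16 383-label
chunk is killed; the fixed cost (cover mask + tabulated columns recomputed inside the `decide`) dominates. This file
moves BOTH tables into emitted DATA, checked once by an equation, and makes the per-label step a comparison of two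
`xorSel`s of ≤ 18 small words:

* `CoverTab` — `cols` (per listed translation `t`: the `k` columns of `ρ_t` as label words = `rhoCols ℓ m Ld L t`) and
  `Ws` (per block: its label basis `W`); the row proves `taus.map (rhoCols …) = T.cols` and `blocks.map BZBlock.W = T.Ws`
  by `decide +kernel` ONCE;
* witness per label `λ` (variable radix, packed base `2^24` per chunk): `w = i + R·(b + B·c)` with `i = 0` (direct) or
  `i = j+1` (translation `taus[j]`), block `b`, combination word `c` over `W_b`; the step checks
  `xorSel W_b c = λ` resp. `= xorSel cols_j λ` (`coverTabStep`);
* drivers `coverTabGoN` (linear, leaves) / `coverTabGoT` (binary split of the range and of the packed numeral),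
  chunk check `coverAutTabWitOK`, property `CoverSpan` (+ `append`), and
* `coverAutTab2_hcover : tables correct → taus in range → CoverSpan … 1 (2^k) → <VERBATIM the conclusion of type-12's
  bzAut_translate_hcover>` — the `hcover` hypothesis of type-10's `bzAut_lower_sound`.

Soundness: `ofBits_xorSel_mem_span` (a selected XOR of `W_b` lies in its label span) and type-12's
`ofBits_xorSel_rhoCols` (the tabulated probe IS `ρ_t *ᵥ λ`). HONEST FRAMING: infrastructure; no certificate is read,
no distance asserted. Tier KERNEL, axioms standard. [folklore]
-/

namespace Summit.Ventures.QEC.Census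

open Matrix Literature.InformationTheory.QuantumCodes Literature.InformationTheory.QuantumCodes.BB

/-! ## Tables and the Bool driver -/

/-- The two tables of a witnessed cover: `cols[j]` = the label-action columns of translation `taus[j]`,
`Ws[b]` = the label basis of block `b`. (definition) -/
structure CoverTab where
  /-- per listed translation, the `k` columns of `ρ_t` as label words -/
  cols : List (List ℕ)
  /-- per block, its label basis `W` (words, bit `i` = logical `i`) -/
  Ws : List (List ℕ)

/-- One label `lam` with packed witness `w = i + R·(b + B·c)`: block `b` must exist and `xorSel Ws[b] c` must equal
`lam` (`i = 0`) or `xorSel cols[j] lam` (`i = j + 1`, translation `j` must exist). (definition) -/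
def coverTabStep (T : CoverTab) (R B lam w : ℕ) : Bool :=
  match T.Ws[(w / R) % B]? with
  | none => false
  | some W =>
    match w % R with
    | 0 => xorSel W (w / R / B) == lam
    | j + 1 =>
      match T.cols[j]? with
      | none => false
      | some cs => xorSel W (w / R / B) == xorSel cs lam

/-- Labels `lam … lam + cnt − 1`, base-`2^24` packed witnesses, linear (structural on `cnt`). (definition) -/
def coverTabGoN (T : CoverTab) (R B : ℕ) : ℕ → ℕ → ℕ → Bool
  | _, _, 0 => true
  | lam, ws, cnt + 1 => coverTabStep T R B lam (ws % 16777216) && coverTabGoN T R B (lam + 1) (ws / 16777216) cnt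

/-- Binary split of the label range (and of the packed numeral) `depth` times, then `coverTabGoN`. (definition) -/
def coverTabGoT (T : CoverTab) (R B : ℕ) : ℕ → ℕ → ℕ → ℕ → Bool
  | 0, lo, cnt, ws => coverTabGoN T R B lo ws cnt
  | depth + 1, lo, cnt, ws =>
    coverTabGoT T R B depth lo (cnt / 2) (ws % 16777216 ^ (cnt / 2)) &&
      coverTabGoT T R B depth (lo + cnt / 2) (cnt - cnt / 2) (ws / 16777216 ^ (cnt / 2))

/-- **Chunk check** (what a row `decide`s per chunk): labels `[lo, lo + cnt)` pass `coverTabGoT` at `depth` with the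
packed witnesses `ws`, radix `R = |taus| + 1`, `B = |blocks|`. (definition) -/
def coverAutTabWitOK (T : CoverTab) (R B depth lo cnt ws : ℕ) : Bool :=
  coverTabGoT T R B depth lo cnt ws

/-! ## Span facts -/

/-- A selected XOR of the words `W` lies, as a label vector, in the span of the `W[l]`. -/
theorem ofBits_xorSel_mem_span (k : ℕ) : ∀ (W : List ℕ) (c : ℕ),
    ofBits k (xorSel W c) ∈ Submodule.span (ZMod 2) (Set.range fun l : Fin W.length => ofBits k W[l])
  | [], c => by simp [xorSel, ofBits_zero]
  | r :: rs, c => by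
    rw [xorSel, ofBits_xor]
    refine Submodule.add_mem _ ?_ ?_
    · by_cases h : c % 2 = 1
      · rw [if_pos h]
        exact Submodule.subset_span ⟨⟨0, by simp⟩, by simp⟩
      · rw [if_neg h, ofBits_zero]
        exact Submodule.zero_mem _
    · refine Submodule.span_mono ?_ (ofBits_xorSel_mem_span k rs (c / 2))
      rintro _ ⟨l, rfl⟩
      exact ⟨⟨l.1 + 1, by simp⟩, by simp⟩

/-! ## The property and the drivers' soundness -/

/-- **Labels `[lo, hi)` are covered in span form** (a predicate on the check's inputs): the label vector lies in some
block's label span, or its tabulated image under some LISTED translation does. (definition) [folklore] -/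
def CoverSpan (ℓ m : ℕ) (Ld L : List ℕ) (taus : List (ℕ × ℕ)) (blocks : List BZBlock) (lo hi : ℕ) : Prop :=
  ∀ lam : ℕ, lo ≤ lam → lam < hi →
    (∃ b : Fin blocks.length, ofBits L.length lam ∈ Submodule.span (ZMod 2)
      (Set.range fun l : Fin (blocks[b]).W.length => ofBits L.length (blocks[b]).W[l])) ∨
    ∃ t ∈ taus, ∃ b : Fin blocks.length, ofBits L.length (xorSel (rhoCols ℓ m Ld L t) lam) ∈ Submodule.span (ZMod 2)
      (Set.range fun l : Fin (blocks[b]).W.length => ofBits L.length (blocks[b]).W[l])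

/-- Glue two adjacent ranges. -/
theorem CoverSpan.append {ℓ m : ℕ} {Ld L : List ℕ} {taus : List (ℕ × ℕ)} {blocks : List BZBlock} {a b c : ℕ}
    (h₁ : CoverSpan ℓ m Ld L taus blocks a b) (h₂ : CoverSpan ℓ m Ld L taus blocks b c) :
    CoverSpan ℓ m Ld L taus blocks a c := fun lam ha hc => by
  rcases Nat.lt_or_ge lam b with hb | hb
  · exact h₁ lam ha hb
  · exact h₂ lam hb hc

section Sound

variable {ℓ m : ℕ} {Ld L : List ℕ} {taus : List (ℕ × ℕ)} {blocks : List BZBlock} {T : CoverTab} {R B : ℕ}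

/-- One witnessed step is a cover fact for its label (given the tables are the true ones). -/
theorem coverTabStep_sound (hcols : taus.map (fun t => rhoCols ℓ m Ld L t) = T.cols)
    (hWs : blocks.map BZBlock.W = T.Ws) {lam w : ℕ} (h : coverTabStep T R B lam w = true) :
    (∃ b : Fin blocks.length, ofBits L.length lam ∈ Submodule.span (ZMod 2)
      (Set.range fun l : Fin (blocks[b]).W.length => ofBits L.length (blocks[b]).W[l])) ∨
    ∃ t ∈ taus, ∃ b : Fin blocks.length, ofBits L.length (xorSel (rhoCols ℓ m Ld L t) lam) ∈ Submodule.span (ZMod 2)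
      (Set.range fun l : Fin (blocks[b]).W.length => ofBits L.length (blocks[b]).W[l]) := by
  unfold coverTabStep at h
  cases hW : T.Ws[(w / R) % B]? with
  | none => rw [hW] at h; exact absurd h (by simp)
  | some W =>
    rw [hW] at h
    -- the block behind `W`
    obtain ⟨b, hbW⟩ : ∃ b : Fin blocks.length, (blocks[b]).W = W := by
      rw [← hWs, List.getElem?_map] at hW
      cases hb : blocks[(w / R) % B]? with
      | none => rw [hb] at hW; exact absurd hW (by simp)
      | some blk =>
        rw [hb] at hW
        obtain ⟨hlt, heq⟩ := List.getElem?_eq_some_iff.1 hb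
        refine ⟨⟨(w / R) % B, hlt⟩, ?_⟩
        simp only [Fin.getElem_fin, heq]
        simpa using hW
    subst hbW
    have hspan := ofBits_xorSel_mem_span L.length (blocks[b]).W (w / R / B)
    simp only at h
    cases hi : w % R with
    | zero =>
      rw [hi] at h
      simp only [beq_iff_eq] at h
      rw [h] at hspan
      exact Or.inl ⟨b, hspan⟩
    | succ j =>
      rw [hi] at h
      simp only at h
      cases hc : T.cols[j]? with
      | none => rw [hc] at h; exact absurd h (by simp)
      | some cs =>
        rw [hc] at h
        simp only [beq_iff_eq] at h
        obtain ⟨t, ht, rfl⟩ : ∃ t ∈ taus, rhoCols ℓ m Ld L t = cs := by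
          rw [← hcols, List.getElem?_map] at hc
          cases htj : taus[j]? with
          | none => rw [htj] at hc; exact absurd hc (by simp)
          | some t => rw [htj] at hc; exact ⟨t, List.mem_of_getElem? htj, by simpa using hc⟩
        rw [h] at hspan
        exact Or.inr ⟨t, ht, b, hspan⟩

/-- The linear driver is sound for its label range. -/
theorem coverTabGoN_sound (hcols : taus.map (fun t => rhoCols ℓ m Ld L t) = T.cols)
    (hWs : blocks.map BZBlock.W = T.Ws) :
    ∀ (cnt lo ws : ℕ), coverTabGoN T R B lo ws cnt = true → CoverSpan ℓ m Ld L taus blocks lo (lo + cnt)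
  | 0, lo, _, _ => fun _ h1 h2 => absurd h2 (by simpa using h1)
  | cnt + 1, lo, ws, h => by
    simp only [coverTabGoN, Bool.and_eq_true] at h
    intro lam h1 h2
    rcases Nat.eq_or_lt_of_le h1 with rfl | hlt
    · exact coverTabStep_sound hcols hWs h.1
    · exact coverTabGoN_sound hcols hWs cnt (lo + 1) (ws / 16777216) h.2 lam hlt (by omega)

/-- The binary-split driver is sound for its label range. -/
theorem coverTabGoT_sound (hcols : taus.map (fun t => rhoCols ℓ m Ld L t) = T.cols)
    (hWs : blocks.map BZBlock.W = T.Ws) :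
    ∀ (depth lo cnt ws : ℕ), coverTabGoT T R B depth lo cnt ws = true → CoverSpan ℓ m Ld L taus blocks lo (lo + cnt)
  | 0, lo, cnt, ws, h => coverTabGoN_sound hcols hWs cnt lo ws h
  | depth + 1, lo, cnt, ws, h => by
    simp only [coverTabGoT, Bool.and_eq_true] at h
    have h₁ := coverTabGoT_sound hcols hWs depth lo (cnt / 2) _ h.1
    have h₂ := coverTabGoT_sound hcols hWs depth (lo + cnt / 2) (cnt - cnt / 2) _ h.2
    have hle : cnt / 2 ≤ cnt := Nat.div_le_self cnt 2
    have heq : lo + cnt / 2 + (cnt - cnt / 2) = lo + cnt := by omega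
    rw [heq] at h₂
    exact CoverSpan.append h₁ h₂

/-- **Chunk ⇒ property**: `coverAutTabWitOK T R B depth lo cnt ws` covers `[lo, lo + cnt)` (tables correct). -/
theorem coverSpan_of_tabWitOK (hcols : taus.map (fun t => rhoCols ℓ m Ld L t) = T.cols)
    (hWs : blocks.map BZBlock.W = T.Ws) {depth lo cnt ws : ℕ}
    (h : coverAutTabWitOK T R B depth lo cnt ws = true) : CoverSpan ℓ m Ld L taus blocks lo (lo + cnt) :=
  coverTabGoT_sound hcols hWs depth lo cnt ws h

end Sound

/-! ## The `hcover` hypothesis of `bzAut_lower_sound` -/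

/-- **Witnessed table cover ⇒ `hcover`** (VERBATIM the conclusion of type-12's `bzAut_translate_hcover`): the listed
translations are in range and the labels `[1, 2^k)` are covered in span form ⇒ every non-zero label `λ : 𝔽₂^k` lies in a
block's label span, or `ρ_t λ` does for a listed `t`, `ρ_t = ldMat n L Ld · ((logVec n L ·) ∘ (translateFlat t)⁻¹)ᵀ`. -/
theorem coverAutTab2_hcover {ℓ m : ℕ} [NeZero ℓ] [NeZero m] {L Ld : List ℕ} {taus : List (ℕ × ℕ)}
    {blocks : List BZBlock}
    (htaus : (taus.all fun t => decide (t.1 < ℓ) && decide (t.2 < m)) = true)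
    (hall : CoverSpan ℓ m Ld L taus blocks 1 (2 ^ L.length)) :
    ∀ lam : Fin L.length → ZMod 2, lam ≠ 0 →
      (∃ b : Fin blocks.length, lam ∈ Submodule.span (ZMod 2)
        (Set.range fun l : Fin (blocks[b]).W.length => ofBits L.length (blocks[b]).W[l])) ∨
      ∃ (a : {t : Mono ℓ m // (((t.1 : Fin ℓ) : ℕ), ((t.2 : Fin m) : ℕ)) ∈ taus}) (b : Fin blocks.length),
        (ldMat (ℓ * m + ℓ * m) L Ld * (Matrix.submatrix (fun i => logVec (ℓ * m + ℓ * m) L i :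
            Matrix (Fin L.length) (Fin (ℓ * m + ℓ * m)) (ZMod 2)) id (BB.translateFlat a.1).symm)ᵀ) *ᵥ lam ∈
          Submodule.span (ZMod 2) (Set.range fun l : Fin (blocks[b]).W.length => ofBits L.length (blocks[b]).W[l]) := by
  intro lam hlam
  obtain ⟨w, hwlt, rfl⟩ : ∃ w, w < 2 ^ L.length ∧ ofBits L.length w = lam :=
    ⟨toBits lam, toBits_lt lam, ofBits_toBits lam⟩
  have hw1 : 1 ≤ w := by
    rcases Nat.eq_zero_or_pos w with rfl | hp
    · exact absurd (ofBits_zero _) hlam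
    · exact hp
  have hL : ∀ j : Fin L.length, (fun i => logVec (ℓ * m + ℓ * m) L i : Matrix (Fin L.length) (Fin (ℓ * m + ℓ * m)) (ZMod 2)) j =
      ofBits (ℓ * m + ℓ * m) (L.getD j 0) := fun j => by
    change ofBits (ℓ * m + ℓ * m) L[j] = ofBits (ℓ * m + ℓ * m) (L.getD j 0)
    rw [List.getD_eq_getElem?_getD, List.getElem?_eq_getElem j.2, Option.getD_some]
    rfl
  simp only [List.all_eq_true, Bool.and_eq_true, decide_eq_true_eq] at htaus
  rcases hall w hw1 hwlt with ⟨b, hb⟩ | ⟨t, ht, b, hb⟩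
  · exact Or.inl ⟨b, hb⟩
  · obtain ⟨h1, h2⟩ := htaus t ht
    refine Or.inr ⟨⟨(⟨t.1, h1⟩, ⟨t.2, h2⟩), by simpa using ht⟩, b, ?_⟩
    have key := ofBits_xorSel_rhoCols (ℓ := ℓ) (m := m) (Ld := Ld) (L := L)
      (Ld' := ldMat (ℓ * m + ℓ * m) L Ld) (L' := fun i => logVec (ℓ * m + ℓ * m) L i)
      (fun i => rfl) hL (⟨t.1, h1⟩, ⟨t.2, h2⟩) w
    simp only at key
    rw [← key]
    exact hb

/-! ## Controls (kernel `decide`) -/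

/-- Control: `k = 1`, one block `W = [1]`, no translations (`R = 1`, `B = 1`): label 1 with witness `c = 1`
(`w = 0 + 1·(0 + 1·1) = 1`): pass at depth 2. -/
example : coverAutTabWitOK ⟨[], [[1]]⟩ 1 1 2 1 1 1 = true := by decide

/-- Control: wrong combination (`c = 0` gives the zero label ≠ 1): fail. -/
example : coverAutTabWitOK ⟨[], [[1]]⟩ 1 1 0 1 1 0 = false := by decide

/-- Control: a witness naming a translation that is not listed: fail (no silent pass). -/
example : coverAutTabWitOK ⟨[], [[1]]⟩ 2 1 0 1 1 1 = false := by decide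

end Summit.Ventures.QEC.Census
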